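import Literature.AlgebraicGeometry.Resolution.KnafKuhlmann2009Prop310
import Literature.AlgebraicGeometry.Resolution.LocalEtaleUniformization
import Literature.AlgebraicGeometry.Resolution.ValuedFunctionFieldsLemmas
import Literature.AlgebraicGeometry.Resolution.RegularLocusPerfectField
import Literature.AlgebraicGeometry.Resolution.SmoothImpliesRegular
import Mathlib.RingTheory.Localization.LocalizationLocalization
import HarnessLib

/-!
# Stacking the Hensel top over the rational base, and translation to the crux's conclusion
# (stmt-ResolutionOfSingularities-16088, line `birth`, branch DiscreteRange, S5 `stub_dr_assembly`)

Setting of the branch: `k` perfect, `K / k` a finitely generated field extension, `O ⊆ K` a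
valuation ring containing `k`, `{t} ∪ s ⊆ O` algebraically independent over `k`,
`L = k(t, s) ⊆ K`, and `K = L(η)` with `η ∈ O` a HENSEL ROOT over `O ∩ L` (a root of a monic `f`
with coefficients in `O ∩ L` and `v(f'(η)) = 0`). Hypothesis `hbase` (stub S3): every finite
`Z ⊆ O ∩ L` lies in the local ring at the centre of a finitely generated `k`-subalgebra
`S ⊆ O ∩ L` containing `{t} ∪ s` which is REGULAR at the centre.

Conclusion (the crux's relative local uniformization along `O`): every finitely generated
`k`-subalgebra `R ⊆ O` is dominated by a finitely generated `k`-subalgebra `A ⊆ O` with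
`Frac A = K` that is regular at the centre `𝔪_O ∩ A`.

Proof — everything in the ambient vocabulary `IsSmoothlyUniformizableIn` of the tree
(`ValuedFunctionFields.lean`), inside the valued field `(K, O)` with the tower of subfields
`k ⊆ L ⊆ K`:

1. (rational base) `hbase` says that `(O ∩ L, Z)` is smoothly `k`-uniformizable for every finite
   `Z ⊆ O ∩ L`: a `k`-subalgebra of finite type over the perfect field `k` which is regular at a
   prime is smooth there (`isSmoothAt_iff_isRegularLocalRing_of_perfectField`, Matsumura §30
   Remark 2), and `L = k(t, s) = Frac k[t, s] ⊆ Frac S`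
   (`isSmoothlyUniformizableIn_of_regularCentre`). Transport the base from `k` to its copy
   `O ∩ k = k` inside `K` (`IsSmoothlyUniformizableIn.of_ringEquiv`).
2. (Hensel top) `(O, Z)` is smoothly `O ∩ L`-uniformizable for every finite `Z ⊆ O`, on the
   standard-étale model `O_L[η][1/μ'(η)]` (`isSmoothlyUniformizableIn_of_henselRoot`,
   Knaf–Kuhlmann 2009 Lemma 3.7).
3. (stacking) Knaf–Kuhlmann 2009, Cor. 3.6 (`knafKuhlmann2009_cor36`): `(O, Z)` is smoothly
   `k`-uniformizable for every finite `Z ⊆ O`; take `Z` = a finite set of generators of `R`.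
4. (translation, `exists_regularModel_of_isSmoothlyUniformizableIn`) from a `k`-model `A ⊆ O` of
   `K`, smooth over `k` at the centre `q` and with `Z ⊆ A_q`, pass to `A' := A[1/d]`, `d ∈ A ∖ q`
   a common denominator of `Z`: then `R ≤ A' ⊆ O`, `A'` is finitely generated, `Frac A' = K`, and
   `A'_{q'} = A_q` (localization of a localization) is regular since smooth over a field implies
   regular (`isRegularLocalRing_of_isSmoothAt`, EGA IV 17.5.8 (iii)).

References: H. Knaf, F.-V. Kuhlmann, *Every place admits local uniformization in a finite
extension of the function field*, Adv. Math. 221 (2009) 428–453, Cor. 3.6 and Lemma 3.7.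
-/

noncomputable section

-- single-problem summit: the doubled namespace component `ResolutionOfSingularities` is forced
set_option linter.dupNamespace false

open IsLocalRing Polynomial Literature.AlgebraicGeometry.Resolution

namespace Summit.ResolutionOfSingularities.ResolutionOfSingularities.Theorems.IndSmoothBirth

/-! ## The rational base: regular at the centre over a perfect field ⇒ smoothly uniformizable -/

/-- **Regular at the centre ⇒ smoothly `k`-uniformizable** (translation of the conclusion of the
rational-base stub into the tree's ambient vocabulary). Let `k` be perfect, `O` a valuation ring
of `K ⊇ k`, `T ⊆ K`, and `S ⊆ O` a finitely generated `k`-subalgebra with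
`T ⊆ S ⊆ k(T)` whose local ring at the centre `𝔪_O ∩ S` is regular, such that every `z ∈ Z` is
`a / b` with `a, b ∈ S`, `v(b) = 0`. Then `(O ∩ k(T), Z)` is smoothly `k`-uniformizable by the
model `S`: `S` is finitely presented (finite type over a field), `Frac S ⊇ k(T)` as
`k(T) = Frac k[T]` and `k[T] ⊆ S`, and `S` is smooth over the PERFECT field `k` at the regular
prime `𝔪_O ∩ S` (Matsumura, *Commutative Ring Theory*, §30 Remark 2). [folklore] -/
theorem isSmoothlyUniformizableIn_of_regularCentre (k K : Type) [Field k] [PerfectField k]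
    [Field K] [Algebra k K] (O : ValuationSubring K) (T : Set K) (S : Subalgebra k K)
    (hS : S.toSubring ≤ O.toSubring) (hSfg : S.FG)
    (hSL : (S : Set K) ⊆ IntermediateField.adjoin k T) (hTS : T ⊆ S)
    (hreg : IsRegularLocalRing (Localization.AtPrime
      (Ideal.comap (Subring.inclusion hS) (IsLocalRing.maximalIdeal O))))
    (Z : Set K) (hZS : ∀ z ∈ Z, ∃ a ∈ S, ∃ b ∈ S, O.valuation b = 1 ∧ z = a / b) :
    IsSmoothlyUniformizableIn k O (IntermediateField.adjoin k T).toSubfield Z := by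
  haveI : Algebra.FiniteType k S := S.fg_iff_finiteType.mp hSfg
  haveI : Algebra.FinitePresentation k S :=
    (Algebra.FinitePresentation.of_finiteType (R := k) (A := S)).mp ‹_›
  refine ⟨S, hS, fun x hx => hSL hx, ‹_›, ?_, ?_, hZS⟩
  · intro x hx
    obtain ⟨r, hr, s, hs, rfl⟩ := IntermediateField.mem_adjoin_iff_div.mp
      ((IntermediateField.mem_toSubfield _ x).mp hx)
    exact ⟨r, Algebra.adjoin_le hTS hr, s, Algebra.adjoin_le hTS hs, rfl⟩
  · exact (isSmoothAt_iff_isRegularLocalRing_of_perfectField k S (centre S O hS)).mpr hreg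

/-! ## Translation of smooth `k`-uniformizability of `(O, gens R)` into the crux's conclusion -/

/-- **From a smooth uniformization to a regular model dominating `R`.** If `(O, T)` is smoothly
`k`-uniformizable inside `(K, O)` — an affine `k`-model `A ⊆ O` of `K`, smooth over `k` at the
centre `q = 𝔪_O ∩ A`, with `T ⊆ A_q` — and `R = k[T]`, then `R` is dominated by a finitely
generated `k`-subalgebra `A' ⊆ O` with `Frac A' = K`, regular at its centre. Indeed, for a common
denominator `d ∈ A`, `v(d) = 0`, of the elements of `T`, the algebra `A' := A[1/d]` works:
`T ⊆ A'`, and `A'_{𝔪_O ∩ A'} = A_q` (localization of a localization at a prime avoiding `d`) is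
regular because smooth over a field implies regular (EGA IV 17.5.8 (iii); Görtz–Wedhorn 6.26).
[folklore] -/
theorem exists_regularModel_of_isSmoothlyUniformizableIn (k K : Type) [Field k] [Field K]
    [Algebra k K] (O : ValuationSubring K) (R : Subalgebra k K) (T : Finset K)
    (hT : Algebra.adjoin k (T : Set K) = R) (h : IsSmoothlyUniformizableIn k O ⊤ (T : Set K)) :
    ∃ (A : Subalgebra k K) (h : A.toSubring ≤ O.toSubring), R ≤ A ∧ A.FG ∧ IsFractionRing A K ∧
      IsRegularLocalRing (Localization.AtPrime
        (Ideal.comap (Subring.inclusion h) (IsLocalRing.maximalIdeal O))) := by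
  classical
  obtain ⟨A, hAV, -, hfp, hfrac, hsm, hZ⟩ := h
  haveI := hfp
  haveI : Algebra.IsSmoothAt k (centre A O hAV) := hsm
  -- smooth over a field ⇒ regular
  have hregA : IsRegularLocalRing (Localization.AtPrime (centre A O hAV)) :=
    isRegularLocalRing_of_isSmoothAt k A (centre A O hAV)
  -- one denominator `d ∈ A`, a unit of `O`, with `w * d ∈ A` for all `w ∈ T`
  obtain ⟨d, hdA, hvd, hTd⟩ : ∃ d ∈ A, O.valuation d = 1 ∧ ∀ w ∈ T, w * d ∈ A := by
    choose a ha b hb hvb hab using hZ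
    refine ⟨∏ w ∈ T.attach, b w.1 w.2, prod_mem fun w _ => hb w.1 w.2, ?_, ?_⟩
    · rw [map_prod]
      exact Finset.prod_eq_one fun w _ => hvb w.1 w.2
    · intro w hw
      have hb0 : b w hw ≠ 0 := fun h0 => by simpa [h0] using hvb w hw
      have hwb : w * b w hw = a w hw := by
        have h := hab w hw
        calc w * b w hw = a w hw / b w hw * b w hw := by rw [← h]
          _ = a w hw := div_mul_cancel₀ _ hb0
      have hprod := Finset.mul_prod_erase T.attach (fun w' => b w'.1 w'.2)
        (Finset.mem_attach _ ⟨w, hw⟩)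
      rw [← hprod, ← mul_assoc, hwb]
      exact mul_mem (ha w hw) (prod_mem fun w' _ => hb w'.1 w'.2)
  have hd0 : d ≠ 0 := fun h0 => by simp [h0] at hvd
  -- the model `A' := A[1/d]`
  have hA'V : (locAway A d hdA).toSubring ≤ O.toSubring := locAway_le_valuationSubring hAV hvd
  have hAfg : A.FG := (Subalgebra.fg_iff_finiteType A).mpr inferInstance
  refine ⟨locAway A d hdA, hA'V, ?_, fg_locAway hd0 hAfg, ?_, ?_⟩
  · -- `R ≤ A[1/d]`
    rw [← hT]
    exact Algebra.adjoin_le fun w hw => ⟨1, by rw [pow_one]; exact hTd w hw⟩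
  · -- `Frac A[1/d] = K`
    refine IsFractionRing.of_field _ K fun z => ?_
    obtain ⟨a', ha', b', hb', rfl⟩ := hfrac z (Subfield.mem_top z)
    exact ⟨⟨a', le_locAway ha'⟩, ⟨b', le_locAway hb'⟩, rfl⟩
  · -- `A[1/d]` localised at its centre is `A_q`
    letI : Algebra A (locAway A d hdA) :=
      (Subalgebra.inclusion (le_locAway (B := A) (f := d) (hf := hdA))).toRingHom.toAlgebra
    haveI : IsLocalization.Away (⟨d, hdA⟩ : A) (locAway A d hdA) :=
      isLocalization_locAway (B := A) (hf := hdA) hd0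
    have hloc : IsLocalization.AtPrime (Localization.AtPrime (centre (locAway A d hdA) O hA'V))
        ((centre (locAway A d hdA) O hA'V).comap (algebraMap A (locAway A d hdA))) :=
      IsLocalization.isLocalization_isLocalization_atPrime_isLocalization
        (Submonoid.powers (⟨d, hdA⟩ : A)) (Localization.AtPrime (centre (locAway A d hdA) O hA'V))
        (centre (locAway A d hdA) O hA'V)
    have hM : (centre A O hAV).primeCompl =
        ((centre (locAway A d hdA) O hA'V).comap (algebraMap A (locAway A d hdA))).primeCompl := by
      ext x
      rw [Ideal.mem_primeCompl_iff, Ideal.mem_primeCompl_iff, Ideal.mem_comap, mem_centre_iff,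
        mem_centre_iff]
      rfl
    haveI : IsLocalization (centre A O hAV).primeCompl
        (Localization.AtPrime (centre (locAway A d hdA) O hA'V)) := by
      rw [hM]; exact hloc
    exact IsRegularLocalRing.of_ringEquiv
      (IsLocalization.algEquiv (centre A O hAV).primeCompl
        (Localization.AtPrime (centre A O hAV))
        (Localization.AtPrime (centre (locAway A d hdA) O hA'V))).toRingEquiv

/-! ## S5: stacking + translation -/

/-- **S5 of the DiscreteRange branch: stacking and translation** (Knaf–Kuhlmann 2009, Cor. 3.6:
"Let `(F|K,P)` be a finitely generated, valued field extension and `L` an intermediate field of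
`F|K`. If `P|_L` is strongly smoothly `O_K`-uniformizable and `P` is strongly smoothly
`O_L`-uniformizable, then `P` is strongly smoothly `O_K`-uniformizable."). Inside `(K, O)` with
the tower `k ⊆ L = k(t, s) ⊆ K`: the rational base `L` is strongly smoothly `k`-uniformizable by
`hbase` (regular ⇒ smooth over the perfect field `k`), `K = L(η)` is strongly smoothly
`O ∩ L`-uniformizable on the standard-étale model of the Hensel root `η` (KK09 Lemma 3.7,
`isSmoothlyUniformizableIn_of_henselRoot`), Cor. 3.6 (`knafKuhlmann2009_cor36`) stacks the two,
and a smooth `k`-uniformization of `(O, gens R)` yields a finitely generated regular model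
`A ⊇ R` of `K` inside `O` (`exists_regularModel_of_isSmoothlyUniformizableIn`).
[cite: KnafKuhlmann2009, Cor. 3.6] -/
theorem stub_dr_assembly (k K : Type) [Field k] [PerfectField k] [Field K] [Algebra k K]
    (hK : (⊤ : IntermediateField k K).FG) (O : ValuationSubring K)
    (hO : ∀ c : k, algebraMap k K c ∈ O) (t : K) (s : Finset K) (htO : t ∈ O) (hsO : ∀ y ∈ s, y ∈ O)
    (hind : AlgebraicIndependent k ((↑) : ↥(insert t (↑s : Set K)) → K))
    (hbase : ∀ Z : Finset K,
      (∀ z ∈ Z, z ∈ O ∧ z ∈ IntermediateField.adjoin k (insert t (↑s : Set K))) →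
      ∃ (S : Subalgebra k K) (hS : S.toSubring ≤ O.toSubring), S.FG ∧
        (S : Set K) ⊆ IntermediateField.adjoin k (insert t (↑s : Set K)) ∧
        insert t (↑s : Set K) ⊆ S ∧
        IsRegularLocalRing (Localization.AtPrime
          (Ideal.comap (Subring.inclusion hS) (IsLocalRing.maximalIdeal O))) ∧
        ∀ z ∈ Z, ∃ a ∈ S, ∃ b ∈ S, O.valuation b = 1 ∧ z = a / b)
    (η : K) (hηO : η ∈ O)
    (hgen : Subfield.closure
      (((IntermediateField.adjoin k (insert t (↑s : Set K))).toSubfield : Set K) ∪ {η}) = ⊤)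
    (f : Polynomial K) (hfmon : f.Monic)
    (hfcoeff : ∀ i, f.coeff i ∈ O ∧ f.coeff i ∈ IntermediateField.adjoin k (insert t (↑s : Set K)))
    (hfη : f.eval η = 0) (hfder : O.valuation ((Polynomial.derivative f).eval η) = 1)
    (R : Subalgebra k K) (hR : R.FG) (hRO : R.toSubring ≤ O.toSubring) :
    ∃ (A : Subalgebra k K) (h : A.toSubring ≤ O.toSubring), R ≤ A ∧ A.FG ∧ IsFractionRing A K ∧
      IsRegularLocalRing (Localization.AtPrime
        (Ideal.comap (Subring.inclusion h) (IsLocalRing.maximalIdeal O))) := by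
  classical
  -- standing hypotheses of the branch that this step does not use (`hbase`, `hgen` carry them)
  have _h₁ := hK
  have _h₂ := htO
  have _h₃ := hsO
  have _h₄ := hind
  -- the copy `K₀` of `k` inside `K` lies in `L = k(t, s)`
  have hK₀L : (algebraMap k K).fieldRange ≤
      (IntermediateField.adjoin k (insert t (↑s : Set K))).toSubfield := by
    intro x hx
    obtain ⟨c, rfl⟩ := RingHom.mem_fieldRange.mp hx
    exact (IntermediateField.adjoin k _).algebraMap_mem c
  -- `k ≃ O ∩ K₀ (= K₀)`, compatibly with the maps to `K`
  have hmem : ∀ c : k, algebraMap k K c ∈ O.toSubring ⊓ (algebraMap k K).fieldRange.toSubring :=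
    fun c => Subring.mem_inf.mpr ⟨hO c, RingHom.mem_fieldRange.mpr ⟨c, rfl⟩⟩
  let f₀ : k →+* ↥(O.toSubring ⊓ (algebraMap k K).fieldRange.toSubring) :=
    (algebraMap k K).codRestrict _ hmem
  have hf₀ : Function.Bijective f₀ := by
    refine ⟨fun a b h => (algebraMap k K).injective (congrArg Subtype.val h), fun x => ?_⟩
    have hx : (x : K) ∈ (algebraMap k K).fieldRange := (Subring.mem_inf.mp x.2).2
    obtain ⟨c, hc⟩ := RingHom.mem_fieldRange.mp hx
    exact ⟨c, Subtype.ext hc⟩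
  let e : k ≃+* ↥(O.toSubring ⊓ (algebraMap k K).fieldRange.toSubring) :=
    RingEquiv.ofBijective f₀ hf₀
  have he : ∀ r, algebraMap (↥(O.toSubring ⊓ (algebraMap k K).fieldRange.toSubring)) K (e r) =
      algebraMap k K r := fun _ => rfl
  have he' : ∀ r, algebraMap k K (e.symm r) =
      algebraMap (↥(O.toSubring ⊓ (algebraMap k K).fieldRange.toSubring)) K r := fun r => by
    rw [← he, e.apply_symm_apply]
  -- (1) the rational base `L` is strongly smoothly `O ∩ K₀`-uniformizable
  have hL : ∀ Z : Finset K,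
      (∀ z ∈ Z, z ∈ O ∧ z ∈ (IntermediateField.adjoin k (insert t (↑s : Set K))).toSubfield) →
      IsSmoothlyUniformizableIn ↥(O.toSubring ⊓ (algebraMap k K).fieldRange.toSubring) O
        (IntermediateField.adjoin k (insert t (↑s : Set K))).toSubfield (Z : Set K) := by
    intro Z hZ
    obtain ⟨S, hS, hSfg, hSL, htsS, hreg, hZS⟩ :=
      hbase Z fun z hz => ⟨(hZ z hz).1, (IntermediateField.mem_toSubfield _ _).mp (hZ z hz).2⟩
    exact (isSmoothlyUniformizableIn_of_regularCentre k K O _ S hS hSfg hSL htsS hreg (Z : Set K)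
      fun z hz => hZS z (Finset.mem_coe.mp hz)).of_ringEquiv e he
  -- (2) the Hensel top: `K = L(η)` is strongly smoothly `O ∩ L`-uniformizable
  have hF : ∀ Z : Finset K, (∀ z ∈ Z, z ∈ O ∧ z ∈ (⊤ : Subfield K)) →
      IsSmoothlyUniformizableIn
        ↥(O.toSubring ⊓ (IntermediateField.adjoin k (insert t (↑s : Set K))).toSubfield.toSubring)
        O ⊤ (Z : Set K) := fun Z hZ =>
    isSmoothlyUniformizableIn_of_henselRoot O _ ⊤ hηO hgen f hfmon
      (fun i => ⟨(hfcoeff i).1, (IntermediateField.mem_toSubfield _ _).mpr (hfcoeff i).2⟩) hfη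
      hfder (Z : Set K) fun z hz => hZ z (Finset.mem_coe.mp hz)
  -- (3) stacking (KK09 Cor. 3.6) above a finite set of generators of `R`
  obtain ⟨T, hT⟩ := hR
  have hTR : (T : Set K) ⊆ R := by
    rw [← hT]
    exact Algebra.subset_adjoin
  have hTO : ∀ z ∈ T, z ∈ O ∧ z ∈ (⊤ : Subfield K) := fun z hz =>
    ⟨hRO (R.mem_toSubring.mpr (hTR (Finset.mem_coe.mpr hz))), Subfield.mem_top z⟩
  have h36 := knafKuhlmann2009_cor36 O hK₀L le_top hL hF T hTO
  -- (4) back to the base `k` and translation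
  exact exists_regularModel_of_isSmoothlyUniformizableIn k K O R T hT (h36.of_ringEquiv e.symm he')

end Summit.ResolutionOfSingularities.ResolutionOfSingularities.Theorems.IndSmoothBirth

end
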